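import Summits.NavierStokesRegularity.NavierStokesRegularity.Theses.SymmetryModuliCount
import Literature.Analysis.FluidPDE.TemperedLinearisedNS
import Literature.Analysis.FluidPDE.KNSSRemark61

/-!
# Disproof of `LinearLiouvilleSeven` — findings (cdisprove, crux stmt-NavierStokesRegularity-4054, route SymmetryModuliCount)

Standing adversary's work file (refuter-cdisprove-stmt-NavierStokesRegularity-4054-0), cycle 1, v4.
Everything outside docstrings is checked Lean; no `sorry`.

The crux (`LL7`): about every `u ∈ A_C` (smooth, div-free, KNSS-mild, `|u| ≤ C/√(−t)` on `t<0`), any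
seven tempered classical solutions `(vᵢ, qᵢ)` of the linearised Navier–Stokes system are linearly
dependent MODULO SLICE-WISE CONSTANTS (`∃ c ≠ 0, ∀ t<0, ∃ b, Σ cᵢ vᵢ(t,·) ≡ b`).

## Index of findings

* §0 NORMAL FORM. `InClassA`, `SevenTempered`, `DependentModSlice`, `linearLiouvilleSeven_iff`
  (`Iff.rfl`: every lemma below is literally about the route decl); `sevenTempered_iff` — the per-index
  hypothesis is verbatim the tree's `IsTemperedLinearisedNSSolution u (v i) (q i)`
  (`Literature/Analysis/FluidPDE/TemperedLinearisedNS.lean`, a real vector space in `(v,q)`).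
  Non-vacuity: `inClassA_zero` (`0 ∈ A_C` iff `0 ≤ C`), `inClassA_neg_empty` (`A_C = ∅` for `C < 0`).
* §1 WHY IT RESISTS (logical core, = triage r1-1 / line galilean-collapse, re-checked here):
  `atZero_of_linearLiouvilleSeven` (LL7 ⇒ its `u = 0` instance `AtZero`),
  `linearLiouvilleSeven_of_typeI_of_atZero` (route TARGET `X = TypeIAncientLiouville` ∧ `AtZero` ⇒ LL7),
  hence `not_typeIAncientLiouville_of_not_linearLiouvilleSeven`: ANY refutation of LL7 that leaves the
  classical anchor `AtZero` standing (tempered ancient Stokes seven-families are dependent mod constants —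
  true: harmonic pressure of linear growth is affine, caloric Liouville; the lead is landing it as
  `stub_anchorOfParts`/`stub_anchorPressure`/…) EXHIBITS a nonzero Type-I ancient mild solution, i.e.
  refutes `X` (open: Bradshaw–Tsai 2017 OP 5.1, Tsai 2018 Conj. 8.8–8.9). So no explicit/small-model kill
  exists; `atZero_of_temperedStokesSliceConstant` records that the single-solution anchor suffices.
  Converse: §4 below.
* §4 THE GALILEAN COLLAPSE, DISPROVER'S FORM (new in v2, sorry-free):
  `linearLiouvilleSeven_false_of_galileanNontrivial : GalileanNontrivial → ¬ LinearLiouvilleSeven`.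
  `GalileanNontrivial` (H) = some `A_C` has an element nonzero somewhere on `t<0` which ADMITS the
  modulated Galilean Jacobi fields `φ′e − φ∂ₑu` as tempered linearised solutions (`GalileanAdmissible`,
  true for all of `A_C` by KNSS Prop 4.1 + the Galilean Jacobi identity, unformalised). Everything else
  is PROVED: admissible modulations `φ_k = (1−t)^{-(k+1)}` (`phiMod_isModulation`), freezing of `∂ₑu`
  off the finite zero set of the total modulation (`fderiv_apply_const_of_sliceConstant`,
  `finite_zeroSet` via `P_c(g)`, `P_c ≠ 0`), frozen partials + Type-I ⇒ constant slices
  (`slice_const_of_frozen`), Oseen equation with a.e.-constant slices ⇒ `u(t,x) = u(s,0)`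
  (`mild_eq_const`), Type-I decay as `s → −∞` ⇒ `u = 0`. So LL7 FAILS AT EVERY NONZERO ADMISSIBLE
  ELEMENT OF `A_C`; modulo the admissibility theorem, `¬LL7 ⟺ ¬X`. Filed as a negative lemma modulo H
  (Theorems/LinearLiouvilleSeven/Negative/LinearLiouvilleSevenFalseOfGalileanNontrivial.lean).
* §2 LOAD-BEARING HYPOTHESES / NATURAL STRENGTHENINGS, each refuted at the trivial background `u = 0`
  by an explicit seven-family (so "any proof must use …"):
  - (a) `linearLiouvilleSeven_false_without_quotient` — drop "modulo slice-constants" (ask `Σ cᵢvᵢ = 0`):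
    FALSE. Witness: parasitic modes `v = (a−t)⁻¹e`, `q = −(a−t)⁻²⟪e,x⟫` (`paraV`/`paraQ`,
    `paraV_paraQ_isTempered`), seven of them independent (`paraFamily_indep`, three time samples).
  - (a′) `linearLiouvilleSeven_false_uniform_constant` — one constant `b` for all `t` instead of `b(t)`:
    FALSE (same family, four time samples). The slice constants must be allowed to move in time.
  - (b) `linearLiouvilleSeven_false_without_backward_decay` — weaken the velocity growth
    `K/√(−t) + K(1+‖x‖)/(−t)` (which forces `v → 0` as `t → −∞`) to locally-uniform linear growth
    `K(1+(−t)⁻¹)(1+‖x‖)` (implied by it: `sevenLinearGrowth_of_sevenTempered`): FALSE. Witness: the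
    affine modes `v = Lx`, `tr L = 0`, `q = 0` (`linV`, `affL`, `affFamily_indep_modSlice`). This is
    the checked form of the docstring's remark "affine modes `M(t)x` are excluded by … `t → −∞`".
  - (c) `linearLiouvilleSeven_false_without_pressure_bound` (new in v3) — drop ONLY the pressure growth
    bound (velocity still tempered; an honest weakening: `sevenTemperedNoPressureBound_of_sevenTempered`):
    FALSE. Witness: the strain modes `v = (a−t)⁻¹Sx`, `q = −(a−t)⁻²⟪x,Sx⟩/2`, `S` symmetric traceless
    (`strainV`/`strainQ`, `strain_clause`, gradient of the quadratic form `hasFDerivAt_inner_self_clm`),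
    seven of them independent mod slice-constants (`strainFamily_indep_modSlice`, two time samples).
    With (b) this is the complete checked form of "affine modes `M(t)x` are excluded by the pressure
    growth and `t → −∞`": BOTH exclusions are needed, each alone fails.
  SUMMARY OF THE HYPOTHESIS CUBE at `u = 0` (tempered class T = {velocity decay at −∞ (D), pressure
  growth (P)}, conclusion modulo slice constants (Q)): D∧P∧Q — TRUE (anchor); drop Q — FALSE (a);
  Q with time-independent constant — FALSE (a′); drop D — FALSE (b); drop P — FALSE (c).
* §3 REGIMES WITH NO CHEAP KILL (analysis, no Lean): dropping ONLY the mild (Oseen) clause admits the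
  spatially constant drifts `u = β(−t)^{-1/2}e` (Type-I, not mild), but the Galilean change of variables
  `x ↦ x − ∫u` maps tempered solutions about them to tempered STOKES solutions (the shift `|∫u|/(−t) =
  2|β|/√(−t)` is itself tempered), so the conclusion persists; dropping ONLY Type-I admits constant drifts
  `u ≡ b` with the same outcome (KNSS Rem. 6.1 + Galilean shift, linear term `M(x−bt)` killed by the
  decay of the class). For genuinely `x`-dependent NON-Navier–Stokes Type-I drifts the statement IS
  false: the sibling crux `FiniteTangentModuli` (stmt-4055) was REFUTED (`ledger negatives`:
  `Theorems/SymmetryModuliCountFiniteTangentModuliRefutation.lean`, decaying Kolmogorov shear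
  `u = (1−t)⁻¹ sin(x₀) e₁` with the forced/dressed parasitic modes `a^{k+2}cos(x₀)e₁ + B_k(t)e₀` — the
  same mechanism as §4: modulo slice-constants is the wrong quotient about every drift with `(b·∇)u ≢
  const`). That witness is not mild, so it misses LL7; inside `A_C` the mechanism is exactly §4 (`H → ¬LL7`).
* §5 ANTICIPATING THE RESTATEMENT `LL7-mild` (line card galilean-collapse / 4055's repair C′: perturbations
  in the linearised-MILD Oseen/Duhamel gauge, plain dependence, no quotient) — analysis for the planner:
  at `u = 0` it is TRUE trivially (a tempered mild-caloric ancient field is `e^{(t−s)Δ}v(s) → 0` as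
  `s → −∞`, so all seven fields vanish); the modulated Galilean modes of §4 are NOT mild-linearised unless
  `β″ = 0` (accelerated frames carry the non-decaying pressure `−β″·x`), and tempered then forces `β`
  constant, leaving only the three translation Jacobi fields `−(β·∇)u`; so §4 does not bite `LL7-mild`,
  whose content about a nonzero `u ∈ A_C` is "the seven similarity Jacobi fields are dependent" =
  `ForcedSymmetry` (crux 4052). Hence `X ⇒ LL7-mild ⇒ (JacobiTempered-mild ⇒ ForcedSymmetry)`: again no
  explicit kill short of `¬X`, but also no collapse to `X` — the restated crux would be a genuine
  intermediate. (Not formalised here: the linearised-mild class is not yet a tree notion.)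
-/

noncomputable section

open Set Function MeasureTheory InnerProductSpace
open scoped Laplacian ContDiff Topology RealInnerProductSpace BigOperators

set_option linter.dupNamespace false

namespace Summit.NavierStokesRegularity.NavierStokesRegularity.Cruxes.LinearLiouvilleSeven.Disproof

open Literature.Analysis Literature.Analysis.FluidPDE
open Summit.NavierStokesRegularity.NavierStokesRegularity.Theses.SymmetryModuliCount

/-- `ℝ³`. -/
abbrev E3 := EuclideanSpace ℝ (Fin 3)

/-- Membership in the class `A_C` — verbatim the hypothesis block of the crux. -/
def InClassA (C : ℝ) (u : ℝ → E3 → E3) : Prop :=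
  ContDiffOn ℝ (⊤ : ℕ∞) (Function.uncurry u) (Set.Iio 0 ×ˢ Set.univ) ∧
  (∀ t < 0, VectorCalculus.IsDivFree (u t)) ∧
  (∀ s t : ℝ, s < t → t < 0 → ∀ x, u t x = heatFlow (u s) (t - s) x -
    ∫ τ in Set.Ioo s t, ∫ y, oseenKernel (t - τ) (x - y) (u τ y) (u τ y)) ∧
  HasTypeITimeDecay C u

/-- The seven-family hypothesis of the crux — verbatim. -/
def SevenTempered (u : ℝ → E3 → E3) (v : Fin 7 → ℝ → E3 → E3) (q : Fin 7 → ℝ → E3 → ℝ) : Prop :=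
  ∀ i, (ContDiffOn ℝ (⊤ : ℕ∞) (Function.uncurry (v i)) (Set.Iio 0 ×ˢ Set.univ) ∧
    ContDiffOn ℝ (⊤ : ℕ∞) (Function.uncurry (q i)) (Set.Iio 0 ×ˢ Set.univ) ∧
    (∃ K : ℝ, ∀ t < 0, ∀ x, ‖(v i) t x‖ ≤ K / Real.sqrt (-t) + K * (1 + ‖x‖) / (-t) ∧
      |(q i) t x| ≤ K / (-t) + K * (1 + ‖x‖) / Real.sqrt (-t) ^ 3) ∧
    (∀ t < 0, VectorCalculus.IsDivFree ((v i) t)) ∧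
    (∀ t < 0, ∀ x, timeDeriv (v i) t x + convect (u t) ((v i) t) x + convect ((v i) t) (u t) x =
      Laplacian.laplacian ((v i) t) x - gradient ((q i) t) x))

/-- The conclusion of the crux: dependence modulo slice-wise constants. -/
def DependentModSlice (v : Fin 7 → ℝ → E3 → E3) : Prop :=
  ∃ c : Fin 7 → ℝ, c ≠ 0 ∧ ∀ t < 0, ∃ b : E3, ∀ x, ∑ i, c i • v i t x = b

theorem linearLiouvilleSeven_iff :
    LinearLiouvilleSeven ↔ ∀ C u, InClassA C u → ∀ v q, SevenTempered u v q → DependentModSlice v :=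
  Iff.rfl

theorem sevenTempered_iff (u : ℝ → E3 → E3) (v : Fin 7 → ℝ → E3 → E3) (q : Fin 7 → ℝ → E3 → ℝ) :
    SevenTempered u v q ↔ ∀ i, IsTemperedLinearisedNSSolution u (v i) (q i) := by
  refine forall_congr' fun i => ?_
  rw [isTemperedLinearisedNSSolution_iff]

/-! ## Non-vacuity: `0 ∈ A_C` for `0 ≤ C`, and `A_C = ∅` for `C < 0` -/

theorem heatFlow_zero_field (τ : ℝ) : heatFlow (0 : E3 → E3) τ = 0 := by
  unfold heatFlow
  split_ifs with h
  · funext x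
    rw [UnboundedOperators.heatExtension_apply]
    simp
  · rfl

theorem inClassA_zero {C : ℝ} (hC : 0 ≤ C) : InClassA C 0 := by
  refine ⟨contDiffOn_const, ?_, ?_, ?_⟩
  · intro t _ x
    simp [VectorCalculus.divergence]
  · intro s t _ _ x
    have h0 : (0 : ℝ → E3 → E3) s = 0 := rfl
    simp [heatFlow_zero_field, oseenKernel]
  · intro t ht x
    have : 0 < Real.sqrt (-t) := Real.sqrt_pos.2 (by linarith)
    simp only [Pi.zero_apply, norm_zero]
    positivity

theorem inClassA_neg_empty {C : ℝ} (hC : C < 0) (u : ℝ → E3 → E3) : ¬ InClassA C u := by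
  rintro ⟨-, -, -, hT⟩
  have h := hT (-1) (by norm_num) 0
  have : C / Real.sqrt (-(-1 : ℝ)) < 0 := by simp [hC]
  linarith [norm_nonneg (u (-1) 0)]

/-! ## The crux at the trivial background `u = 0` -/

/-- `LinearLiouvilleSeven` specialised to `u = 0`: tempered ancient STOKES seven-families are
dependent modulo slice-constants. -/
def AtZero : Prop :=
  ∀ (v : Fin 7 → ℝ → E3 → E3) (q : Fin 7 → ℝ → E3 → ℝ),
    (∀ i, IsTemperedLinearisedNSSolution (0 : ℝ → E3 → E3) (v i) (q i)) → DependentModSlice v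

theorem atZero_of_linearLiouvilleSeven (h : LinearLiouvilleSeven) : AtZero := by
  intro v q hvq
  exact (linearLiouvilleSeven_iff.1 h) 0 0 (inClassA_zero le_rfl) v q ((sevenTempered_iff 0 v q).2 hvq)

/-- If `u(t, ·) = 0` then the linearised momentum operator about `u` at time `t` is the Stokes
operator. -/
theorem convect_congr_of_slice_zero {u : ℝ → E3 → E3} {t : ℝ} (hu : ∀ x, u t x = 0)
    (w : E3 → E3) (x : E3) :
    convect (u t) w x + convect w (u t) x =
      convect ((0 : ℝ → E3 → E3) t) w x + convect w ((0 : ℝ → E3 → E3) t) x := by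
  have h : u t = 0 := funext hu
  simp [convect, h]

theorem sevenTempered_zero_of_slice_zero {u : ℝ → E3 → E3} (hu : ∀ t < 0, ∀ x, u t x = 0)
    {v : Fin 7 → ℝ → E3 → E3} {q : Fin 7 → ℝ → E3 → ℝ} (h : SevenTempered u v q) :
    SevenTempered 0 v q := by
  intro i
  obtain ⟨h1, h2, h3, h4, h5⟩ := h i
  refine ⟨h1, h2, h3, h4, fun t ht x => ?_⟩
  have := h5 t ht x
  rw [add_assoc, convect_congr_of_slice_zero (hu t ht)] at this
  rwa [add_assoc]

/-- **Sandwich, upper half.** Under the route target `X = TypeIAncientLiouville` the crux is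
equivalent to its `u = 0` instance. -/
theorem linearLiouvilleSeven_of_typeI_of_atZero (hX : TypeIAncientLiouville) (h0 : AtZero) :
    LinearLiouvilleSeven := by
  rw [linearLiouvilleSeven_iff]
  intro C u hu v q hvq
  have hz : ∀ t < 0, ∀ x, u t x = 0 := hX C u hu
  exact h0 v q ((sevenTempered_iff 0 v q).1 (sevenTempered_zero_of_slice_zero hz hvq))

/-- **Any disproof of the crux that leaves the classical `u = 0` anchor standing refutes the route
target `X`** (a nonzero Type-I ancient mild solution must be produced). -/
theorem not_typeIAncientLiouville_of_not_linearLiouvilleSeven (h0 : AtZero)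
    (h : ¬ LinearLiouvilleSeven) : ¬ TypeIAncientLiouville := fun hX =>
  h (linearLiouvilleSeven_of_typeI_of_atZero hX h0)

/-- The single-solution anchor (the lead's `stub_temperedStokesLiouville`, linearised form):
every tempered ancient Stokes solution is slice-wise constant. -/
def TemperedStokesSliceConstant : Prop :=
  ∀ (v : ℝ → E3 → E3) (q : ℝ → E3 → ℝ), IsTemperedLinearisedNSSolution (0 : ℝ → E3 → E3) v q →
    ∀ t < 0, ∃ b : E3, ∀ x, v t x = b

theorem atZero_of_temperedStokesSliceConstant (h : TemperedStokesSliceConstant) : AtZero := by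
  intro v q hvq
  refine ⟨Pi.single 0 1, ?_, fun t ht => ?_⟩
  · intro h0
    have := congrFun h0 0
    simp at this
  · obtain ⟨b, hb⟩ := h (v 0) (q 0) (hvq 0) t ht
    refine ⟨b, fun x => ?_⟩
    simp [Pi.single_apply, hb x]



/-! ## Load-bearing (a): the quotient by slice-wise constants

Dropping "modulo slice-constants" from the conclusion (asking for a genuinely vanishing
combination) makes the statement FALSE already at `u = 0`: the parasitic modes
`v(t,x) = (a − t)⁻¹ e`, `q(t,x) = −(a − t)⁻² ⟪e, x⟫` (`a ≥ 1`, `‖e‖ ≤ 1`) are tempered classical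
Stokes solutions, and seven of them with distinct (profile, direction) are linearly independent. -/

/-- Parasitic (spatially constant) linear mode in direction `e` with time profile `(a − t)⁻¹`. -/
def paraV (a : ℝ) (e : E3) : ℝ → E3 → E3 := fun t _ => (a - t)⁻¹ • e

/-- Its pressure `q(t,x) = −(a − t)⁻² ⟪e, x⟫`, so that `∂ₜ v = −∇q`. -/
def paraQ (a : ℝ) (e : E3) : ℝ → E3 → ℝ := fun t x => -((a - t)⁻¹ ^ 2 * ⟪e, x⟫)

theorem paraV_apply (a : ℝ) (e : E3) (t : ℝ) : paraV a e t = fun _ => (a - t)⁻¹ • e := rfl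

theorem paraQ_apply (a : ℝ) (e : E3) (t : ℝ) :
    paraQ a e t = fun x => -((a - t)⁻¹ ^ 2 * ⟪e, x⟫) := rfl

theorem hasDerivAt_inv_sub {a t : ℝ} (h : a - t ≠ 0) :
    HasDerivAt (fun s : ℝ => (a - s)⁻¹) ((a - t)⁻¹ ^ 2) t := by
  have h1 : HasDerivAt (fun s : ℝ => a - s) (-1) t := (hasDerivAt_id' t).const_sub a
  have h2 : HasDerivAt (fun s : ℝ => (a - s)⁻¹) (-((a - t) ^ 2)⁻¹ * -1) t :=
    (hasDerivAt_inv h).comp t h1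
  convert h2 using 1
  rw [inv_pow]
  ring

theorem gradient_inner_const_left (w x : E3) : gradient (fun y : E3 => ⟪w, y⟫) x = w := by
  refine HasGradientAt.gradient ?_
  rw [hasGradientAt_iff_hasFDerivAt]
  exact (InnerProductSpace.toDual ℝ E3 w).hasFDerivAt

/-- `√(−t)³ ≤ (a − t)²` for `t < 0`, `1 ≤ a` (used for the pressure growth of the parasitic and
strain modes). -/
theorem sqrt_neg_pow_three_le {a t : ℝ} (ha : 1 ≤ a) (ht : t < 0) :
    Real.sqrt (-t) ^ 3 ≤ (a - t) ^ 2 := by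
  set s := Real.sqrt (-t) with hs
  have hs0 : 0 ≤ s := Real.sqrt_nonneg _
  have hs2 : s ^ 2 = -t := by rw [hs, Real.sq_sqrt]; linarith
  have hat : a - t = a + s ^ 2 := by linarith
  rw [hat]
  nlinarith [mul_nonneg (sq_nonneg s) (sq_nonneg (s - 1)), mul_nonneg hs0 (sq_nonneg s),
    sq_nonneg (s ^ 2), mul_nonneg (by linarith : (0:ℝ) ≤ a - 1) (sq_nonneg s)]

theorem contDiffOn_inv_sub_fst {a : ℝ} (ha : 0 ≤ a) :
    ContDiffOn ℝ (⊤ : ℕ∞) (fun p : ℝ × E3 => (a - p.1)⁻¹) (Set.Iio 0 ×ˢ Set.univ) := by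
  refine ContDiffOn.inv (contDiffOn_const.sub contDiffOn_fst) ?_
  rintro ⟨t, x⟩ ⟨ht, -⟩
  simp only [Set.mem_Iio] at ht
  show a - t ≠ 0
  linarith

theorem paraV_paraQ_isTempered {a : ℝ} (ha : 1 ≤ a) {e : E3} (he : ‖e‖ ≤ 1) :
    IsTemperedLinearisedNSSolution (0 : ℝ → E3 → E3) (paraV a e) (paraQ a e) where
  smooth_velocity := by
    change ContDiffOn ℝ (⊤ : ℕ∞) (fun p : ℝ × E3 => (a - p.1)⁻¹ • e) (Set.Iio 0 ×ˢ Set.univ)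
    exact (contDiffOn_inv_sub_fst (by linarith)).smul contDiffOn_const
  smooth_pressure := by
    change ContDiffOn ℝ (⊤ : ℕ∞) (fun p : ℝ × E3 => -((a - p.1)⁻¹ ^ 2 * ⟪e, p.2⟫))
      (Set.Iio 0 ×ˢ Set.univ)
    exact (((contDiffOn_inv_sub_fst (by linarith)).pow 2).mul
      (contDiffOn_const.inner ℝ contDiffOn_snd)).neg
  growth := by
    refine ⟨1, fun t ht x => ⟨?_, ?_⟩⟩
    · have hat : 0 < a - t := by linarith
      have hnt : 0 < -t := by linarith
      show ‖(a - t)⁻¹ • e‖ ≤ _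
      rw [norm_smul, Real.norm_eq_abs, abs_of_pos (inv_pos.2 hat)]
      calc (a - t)⁻¹ * ‖e‖ ≤ (a - t)⁻¹ * 1 := by gcongr
        _ ≤ (-t)⁻¹ := by rw [mul_one]; exact inv_anti₀ hnt (by linarith)
        _ = 1 * (1 + 0) / (-t) := by ring
        _ ≤ 1 * (1 + ‖x‖) / (-t) := by gcongr; exact norm_nonneg _
        _ ≤ 1 / Real.sqrt (-t) + 1 * (1 + ‖x‖) / (-t) := le_add_of_nonneg_left (by positivity)
    · have hat : 0 < a - t := by linarith
      have hnt : 0 < -t := by linarith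
      have hs3 : 0 < Real.sqrt (-t) ^ 3 := pow_pos (Real.sqrt_pos.2 hnt) 3
      show |-((a - t)⁻¹ ^ 2 * ⟪e, x⟫)| ≤ _
      rw [abs_neg, abs_mul, abs_of_nonneg (by positivity : (0:ℝ) ≤ (a - t)⁻¹ ^ 2)]
      have h1 : |⟪e, x⟫| ≤ ‖x‖ := by
        calc |⟪e, x⟫| ≤ ‖e‖ * ‖x‖ := abs_real_inner_le_norm e x
          _ ≤ 1 * ‖x‖ := by gcongr
          _ = ‖x‖ := one_mul _
      have h2 : (a - t)⁻¹ ^ 2 ≤ 1 / Real.sqrt (-t) ^ 3 := by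
        rw [inv_pow, ← one_div]
        exact one_div_le_one_div_of_le hs3 (sqrt_neg_pow_three_le ha ht)
      calc (a - t)⁻¹ ^ 2 * |⟪e, x⟫| ≤ (1 / Real.sqrt (-t) ^ 3) * ‖x‖ := by gcongr
        _ ≤ (1 / Real.sqrt (-t) ^ 3) * (1 + ‖x‖) := by gcongr; linarith
        _ = 1 * (1 + ‖x‖) / Real.sqrt (-t) ^ 3 := by ring
        _ ≤ 1 / (-t) + 1 * (1 + ‖x‖) / Real.sqrt (-t) ^ 3 := le_add_of_nonneg_left (by positivity)
  divFree := fun t _ x => by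
    simp [VectorCalculus.divergence, paraV_apply]
  momentum := fun t ht x => by
    have hat : a - t ≠ 0 := by intro h; linarith
    have e1 : timeDeriv (paraV a e) t x = ((a - t)⁻¹ ^ 2) • e := by
      simp only [timeDeriv, paraV_apply]
      exact ((hasDerivAt_inv_sub hat).smul_const e).deriv
    have e2 : convect ((0 : ℝ → E3 → E3) t) (paraV a e t) x = 0 := by simp [convect]
    have e3 : convect (paraV a e t) ((0 : ℝ → E3 → E3) t) x = 0 := by simp [convect]
    have e4 : Δ (paraV a e t) x = 0 := by
      rw [paraV_apply, InnerProductSpace.laplacian_const, Pi.zero_apply]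
    have e5 : gradient (paraQ a e t) x = (-((a - t)⁻¹ ^ 2)) • e := by
      have : paraQ a e t = fun y : E3 => ⟪(-((a - t)⁻¹ ^ 2)) • e, y⟫ := by
        funext y; simp only [paraQ_apply, real_inner_smul_left, neg_mul]
      rw [this, gradient_inner_const_left]
    rw [e1, e2, e3, e4, e5, add_zero, add_zero, neg_smul, zero_sub, neg_neg]

/-- Seven shifts `a ∈ {1,2,3}` … -/
def shift7 : Fin 7 → ℝ := ![1, 1, 1, 2, 2, 2, 3]
/-- … and directions `e_{dir}`: the seven pairs (shift, dir) are distinct. -/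
def dir7 : Fin 7 → Fin 3 := ![0, 1, 2, 0, 1, 2, 0]

/-- The seven parasitic modes. -/
def paraFamilyV (i : Fin 7) : ℝ → E3 → E3 := paraV (shift7 i) (EuclideanSpace.single (dir7 i) 1)
/-- Their pressures. -/
def paraFamilyQ (i : Fin 7) : ℝ → E3 → ℝ := paraQ (shift7 i) (EuclideanSpace.single (dir7 i) 1)

theorem one_le_shift7 (i : Fin 7) : 1 ≤ shift7 i := by
  fin_cases i <;> simp [shift7]

theorem paraFamilyV_apply (i : Fin 7) (t : ℝ) (x : E3) :
    paraFamilyV i t x = (shift7 i - t)⁻¹ • EuclideanSpace.single (dir7 i) 1 := rfl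

theorem paraFamily_isTempered (i : Fin 7) :
    IsTemperedLinearisedNSSolution (0 : ℝ → E3 → E3) (paraFamilyV i) (paraFamilyQ i) :=
  paraV_paraQ_isTempered (one_le_shift7 i) (by simp)

/-- The seven parasitic modes are linearly independent as space–time fields (three time samples
suffice). -/
theorem paraFamily_indep (c : Fin 7 → ℝ)
    (h : ∀ t < 0, ∀ x : E3, ∑ i, c i • paraFamilyV i t x = 0) : c = 0 := by
  have k01 := congrArg (fun w : E3 => ⟪EuclideanSpace.single (0 : Fin 3) (1 : ℝ), w⟫) (h (-1) (by norm_num) 0)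
  have k02 := congrArg (fun w : E3 => ⟪EuclideanSpace.single (0 : Fin 3) (1 : ℝ), w⟫) (h (-2) (by norm_num) 0)
  have k03 := congrArg (fun w : E3 => ⟪EuclideanSpace.single (0 : Fin 3) (1 : ℝ), w⟫) (h (-3) (by norm_num) 0)
  have k11 := congrArg (fun w : E3 => ⟪EuclideanSpace.single (1 : Fin 3) (1 : ℝ), w⟫) (h (-1) (by norm_num) 0)
  have k12 := congrArg (fun w : E3 => ⟪EuclideanSpace.single (1 : Fin 3) (1 : ℝ), w⟫) (h (-2) (by norm_num) 0)
  have k21 := congrArg (fun w : E3 => ⟪EuclideanSpace.single (2 : Fin 3) (1 : ℝ), w⟫) (h (-1) (by norm_num) 0)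
  have k22 := congrArg (fun w : E3 => ⟪EuclideanSpace.single (2 : Fin 3) (1 : ℝ), w⟫) (h (-2) (by norm_num) 0)
  simp [Fin.sum_univ_seven, paraFamilyV_apply, shift7, dir7, inner_add_right, inner_smul_right,
    EuclideanSpace.inner_single_left] at k01 k02 k03 k11 k12 k21 k22
  norm_num at k01 k02 k03 k11 k12 k21 k22
  funext i
  fin_cases i <;> simp <;> linarith

/-- The crux WITHOUT the quotient: a genuinely vanishing nontrivial combination. -/
def LinearLiouvilleSevenWithoutQuotient : Prop :=
  ∀ C u, InClassA C u → ∀ v q, SevenTempered u v q →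
    ∃ c : Fin 7 → ℝ, c ≠ 0 ∧ ∀ t < 0, ∀ x, ∑ i, c i • v i t x = 0

/-- **Load-bearing (a).** Any proof of the crux must use the quotient by slice-wise constants:
without it the statement fails at `u = 0` (parasitic modes `b(t) = (a−t)⁻¹e`, `q = −b'·x`). -/
theorem linearLiouvilleSeven_false_without_quotient : ¬ LinearLiouvilleSevenWithoutQuotient := by
  intro h
  obtain ⟨c, hc, hzero⟩ := h 0 0 (inClassA_zero le_rfl) paraFamilyV paraFamilyQ
    ((sevenTempered_iff 0 _ _).2 paraFamily_isTempered)
  exact hc (paraFamily_indep c hzero)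



/-- **A natural strengthening refuted: one constant for all times.** Replacing the slice-wise
constants `b(t)` of the conclusion by a single vector `b` is FALSE at `u = 0` (same parasitic
family; four time samples). -/
def LinearLiouvilleSevenUniformConstant : Prop :=
  ∀ C u, InClassA C u → ∀ v q, SevenTempered u v q →
    ∃ c : Fin 7 → ℝ, c ≠ 0 ∧ ∃ b : E3, ∀ t < 0, ∀ x, ∑ i, c i • v i t x = b

theorem paraFamily_indep_uniform (c : Fin 7 → ℝ) (b : E3)
    (h : ∀ t < 0, ∀ x : E3, ∑ i, c i • paraFamilyV i t x = b) : c = 0 := by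
  have k01 := congrArg (fun w : E3 => ⟪EuclideanSpace.single (0 : Fin 3) (1 : ℝ), w⟫) (h (-1) (by norm_num) 0)
  have k02 := congrArg (fun w : E3 => ⟪EuclideanSpace.single (0 : Fin 3) (1 : ℝ), w⟫) (h (-2) (by norm_num) 0)
  have k03 := congrArg (fun w : E3 => ⟪EuclideanSpace.single (0 : Fin 3) (1 : ℝ), w⟫) (h (-3) (by norm_num) 0)
  have k04 := congrArg (fun w : E3 => ⟪EuclideanSpace.single (0 : Fin 3) (1 : ℝ), w⟫) (h (-4) (by norm_num) 0)
  have k11 := congrArg (fun w : E3 => ⟪EuclideanSpace.single (1 : Fin 3) (1 : ℝ), w⟫) (h (-1) (by norm_num) 0)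
  have k12 := congrArg (fun w : E3 => ⟪EuclideanSpace.single (1 : Fin 3) (1 : ℝ), w⟫) (h (-2) (by norm_num) 0)
  have k13 := congrArg (fun w : E3 => ⟪EuclideanSpace.single (1 : Fin 3) (1 : ℝ), w⟫) (h (-3) (by norm_num) 0)
  have k21 := congrArg (fun w : E3 => ⟪EuclideanSpace.single (2 : Fin 3) (1 : ℝ), w⟫) (h (-1) (by norm_num) 0)
  have k22 := congrArg (fun w : E3 => ⟪EuclideanSpace.single (2 : Fin 3) (1 : ℝ), w⟫) (h (-2) (by norm_num) 0)
  have k23 := congrArg (fun w : E3 => ⟪EuclideanSpace.single (2 : Fin 3) (1 : ℝ), w⟫) (h (-3) (by norm_num) 0)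
  simp [Fin.sum_univ_seven, paraFamilyV_apply, shift7, dir7, inner_add_right, inner_smul_right,
    EuclideanSpace.inner_single_left] at k01 k02 k03 k04 k11 k12 k13 k21 k22 k23
  norm_num at k01 k02 k03 k04 k11 k12 k13 k21 k22 k23
  funext i
  fin_cases i <;> simp <;> linarith

theorem linearLiouvilleSeven_false_uniform_constant : ¬ LinearLiouvilleSevenUniformConstant := by
  intro h
  obtain ⟨c, hc, b, hb⟩ := h 0 0 (inClassA_zero le_rfl) paraFamilyV paraFamilyQ
    ((sevenTempered_iff 0 _ _).2 paraFamily_isTempered)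
  exact hc (paraFamily_indep_uniform c b hb)

/-! ## Load-bearing (b): the backward decay built into "tempered" (affine modes)

The velocity bound `‖v‖ ≤ K/√(−t) + K(1+‖x‖)/(−t)` forces `v → 0` as `t → −∞`. Weakening it to
locally-uniform linear growth `‖v‖ ≤ K(1 + (−t)⁻¹)(1 + ‖x‖)` (which it implies, see
`sevenLinearGrowth_of_sevenTempered`) lets in the time-independent linear modes `v = Lx`,
`tr L = 0`, `q = 0`, seven of which are independent modulo slice-constants — already at `u = 0`.
So any proof must use the decay of the tempered class at `t = −∞` (this is what kills the affine
modes `M x`; cf. the crux docstring). -/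

/-- The seven-family hypothesis with the velocity growth weakened to locally-uniform linear growth
(no decay as `t → −∞`); the other four clauses verbatim. -/
def SevenLinearGrowth (u : ℝ → E3 → E3) (v : Fin 7 → ℝ → E3 → E3) (q : Fin 7 → ℝ → E3 → ℝ) :
    Prop :=
  ∀ i, (ContDiffOn ℝ (⊤ : ℕ∞) (Function.uncurry (v i)) (Set.Iio 0 ×ˢ Set.univ) ∧
    ContDiffOn ℝ (⊤ : ℕ∞) (Function.uncurry (q i)) (Set.Iio 0 ×ˢ Set.univ) ∧
    (∃ K : ℝ, ∀ t < 0, ∀ x, ‖(v i) t x‖ ≤ K * (1 + (-t)⁻¹) * (1 + ‖x‖) ∧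
      |(q i) t x| ≤ K / (-t) + K * (1 + ‖x‖) / Real.sqrt (-t) ^ 3) ∧
    (∀ t < 0, VectorCalculus.IsDivFree ((v i) t)) ∧
    (∀ t < 0, ∀ x, timeDeriv (v i) t x + convect (u t) ((v i) t) x + convect ((v i) t) (u t) x =
      Laplacian.laplacian ((v i) t) x - gradient ((q i) t) x))

theorem one_div_sqrt_le {s : ℝ} (hs : 0 < s) : 1 / Real.sqrt s ≤ 1 + s⁻¹ := by
  have hr : 0 < Real.sqrt s := Real.sqrt_pos.2 hs
  have hss : Real.sqrt s * Real.sqrt s = s := Real.mul_self_sqrt hs.le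
  have key : s⁻¹ * Real.sqrt s = (Real.sqrt s)⁻¹ := by
    calc s⁻¹ * Real.sqrt s = (Real.sqrt s * Real.sqrt s)⁻¹ * Real.sqrt s := by rw [hss]
      _ = (Real.sqrt s)⁻¹ := by rw [mul_inv, mul_assoc, inv_mul_cancel₀ hr.ne', mul_one]
  rw [div_le_iff₀ hr, add_mul, one_mul, key]
  by_cases h1 : 1 ≤ Real.sqrt s
  · linarith [inv_nonneg.2 hr.le]
  · have : 1 ≤ (Real.sqrt s)⁻¹ := (one_le_inv₀ hr).2 (le_of_lt (not_le.1 h1))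
    linarith

/-- The weakened class contains the tempered class (so (b) below is an honest weakening). -/
theorem sevenLinearGrowth_of_sevenTempered {u : ℝ → E3 → E3} {v : Fin 7 → ℝ → E3 → E3}
    {q : Fin 7 → ℝ → E3 → ℝ} (h : SevenTempered u v q) : SevenLinearGrowth u v q := by
  intro i
  obtain ⟨h1, h2, ⟨K, hK⟩, h4, h5⟩ := h i
  refine ⟨h1, h2, ⟨2 * |K|, fun t ht x => ⟨?_, ?_⟩⟩, h4, h5⟩
  · have hnt : 0 < -t := by linarith
    have hv := (hK t ht x).1
    have hK' : K ≤ |K| := le_abs_self K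
    have hx : 0 ≤ ‖x‖ := norm_nonneg x
    have hsq := one_div_sqrt_le hnt
    have hspos : 0 < 1 / Real.sqrt (-t) := by positivity
    calc ‖v i t x‖ ≤ K / Real.sqrt (-t) + K * (1 + ‖x‖) / (-t) := hv
      _ ≤ |K| / Real.sqrt (-t) + |K| * (1 + ‖x‖) / (-t) := by gcongr
      _ = |K| * (1 / Real.sqrt (-t)) * 1 + |K| * (-t)⁻¹ * (1 + ‖x‖) := by ring
      _ ≤ |K| * (1 + (-t)⁻¹) * (1 + ‖x‖) + |K| * (1 + (-t)⁻¹) * (1 + ‖x‖) := by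
          gcongr
          · linarith
          · linarith [inv_pos.2 hnt]
      _ = 2 * |K| * (1 + (-t)⁻¹) * (1 + ‖x‖) := by ring
  · have hnt : 0 < -t := by linarith
    have hq := (hK t ht x).2
    have hK' : K ≤ 2 * |K| := by linarith [le_abs_self K, abs_nonneg K]
    have hs3 : 0 < Real.sqrt (-t) ^ 3 := pow_pos (Real.sqrt_pos.2 hnt) 3
    calc |q i t x| ≤ K / (-t) + K * (1 + ‖x‖) / Real.sqrt (-t) ^ 3 := hq
      _ ≤ 2 * |K| / (-t) + 2 * |K| * (1 + ‖x‖) / Real.sqrt (-t) ^ 3 := by gcongr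

/-- The crux with the tempered velocity bound weakened to locally-uniform linear growth. -/
def LinearLiouvilleSevenWithoutBackwardDecay : Prop :=
  ∀ C u, InClassA C u → ∀ v q, SevenLinearGrowth u v q → DependentModSlice v

/-- A time-independent linear mode `v(t, x) = L x` (pressure `0`). -/
def linV (L : E3 →L[ℝ] E3) : ℝ → E3 → E3 := fun _ x => L x

theorem linV_apply (L : E3 →L[ℝ] E3) (t : ℝ) : linV L t = ⇑L := rfl

theorem laplacian_clm (L : E3 →L[ℝ] E3) (x : E3) : Δ (⇑L : E3 → E3) x = 0 := by
  have h1 : fderiv ℝ (⇑L : E3 → E3) = fun _ => L := funext fun y => L.fderiv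
  rw [InnerProductSpace.laplacian_eq_iteratedFDeriv_stdOrthonormalBasis]
  simp [iteratedFDeriv_two_apply, h1]

theorem divergence_clm (L : E3 →L[ℝ] E3) (x : E3) :
    VectorCalculus.divergence (⇑L : E3 → E3) x =
      ∑ i, ⟪EuclideanSpace.single i (1 : ℝ), L (EuclideanSpace.single i 1)⟫ := by
  rw [divergence_eq_sum_inner_fderiv (EuclideanSpace.basisFun (Fin 3) ℝ), L.fderiv]
  simp

/-- Linear modes with `tr L = 0` are classical Stokes solutions in the linear-growth class. -/
theorem linV_sevenLinearGrowth_clause (L : E3 →L[ℝ] E3)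
    (htr : ∑ i, ⟪EuclideanSpace.single i (1 : ℝ), L (EuclideanSpace.single i 1)⟫ = 0) :
    (ContDiffOn ℝ (⊤ : ℕ∞) (Function.uncurry (linV L)) (Set.Iio 0 ×ˢ Set.univ) ∧
    ContDiffOn ℝ (⊤ : ℕ∞) (Function.uncurry (fun (_ : ℝ) (_ : E3) => (0 : ℝ))) (Set.Iio 0 ×ˢ Set.univ) ∧
    (∃ K : ℝ, ∀ t < 0, ∀ x, ‖(linV L) t x‖ ≤ K * (1 + (-t)⁻¹) * (1 + ‖x‖) ∧
      |(fun (_ : ℝ) (_ : E3) => (0 : ℝ)) t x| ≤ K / (-t) + K * (1 + ‖x‖) / Real.sqrt (-t) ^ 3) ∧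
    (∀ t < 0, VectorCalculus.IsDivFree ((linV L) t)) ∧
    (∀ t < 0, ∀ x, timeDeriv (linV L) t x + convect ((0 : ℝ → E3 → E3) t) ((linV L) t) x +
      convect ((linV L) t) ((0 : ℝ → E3 → E3) t) x =
      Laplacian.laplacian ((linV L) t) x - gradient ((fun (_ : ℝ) (_ : E3) => (0 : ℝ)) t) x)) := by
  refine ⟨?_, contDiffOn_const, ⟨‖L‖, fun t ht x => ⟨?_, ?_⟩⟩, ?_, ?_⟩
  · change ContDiffOn ℝ (⊤ : ℕ∞) (fun p : ℝ × E3 => L p.2) (Set.Iio 0 ×ˢ Set.univ)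
    exact (L.contDiff.comp contDiff_snd).contDiffOn
  · have hnt : 0 < -t := by linarith
    show ‖L x‖ ≤ _
    calc ‖L x‖ ≤ ‖L‖ * ‖x‖ := L.le_opNorm x
      _ = ‖L‖ * 1 * ‖x‖ := by ring
      _ ≤ ‖L‖ * (1 + (-t)⁻¹) * (1 + ‖x‖) := by
          gcongr
          · linarith [inv_pos.2 hnt]
          · linarith
  · have hnt : 0 < -t := by linarith
    simp only [abs_zero]
    positivity
  · intro t _ x
    show VectorCalculus.divergence (⇑L) x = 0
    rw [divergence_clm, htr]
  · intro t _ x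
    have e1 : timeDeriv (linV L) t x = 0 := by simp [timeDeriv, linV]
    have e2 : convect ((0 : ℝ → E3 → E3) t) ((linV L) t) x = 0 := by simp [convect]
    have e3 : convect ((linV L) t) ((0 : ℝ → E3 → E3) t) x = 0 := by simp [convect]
    have e4 : Δ ((linV L) t) x = 0 := by rw [linV_apply, laplacian_clm]
    have e5 : gradient ((fun (_ : ℝ) (_ : E3) => (0 : ℝ)) t) x = 0 := by
      show gradient (fun _ : E3 => (0 : ℝ)) x = 0
      exact gradient_fun_const x 0
    rw [e1, e2, e3, e4, e5]; simp

/-- The elementary map `x ↦ x_b e_a`. -/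
def eMap (a b : Fin 3) : E3 →L[ℝ] E3 :=
  (EuclideanSpace.proj b).smulRight (EuclideanSpace.single a (1 : ℝ))

theorem eMap_apply (a b : Fin 3) (x : E3) : eMap a b x = x b • EuclideanSpace.single a 1 := rfl

/-- Seven traceless linear maps (six off-diagonal elementary maps and `diag(1, −1, 0)`). -/
def affL : Fin 7 → (E3 →L[ℝ] E3) :=
  ![eMap 0 1, eMap 0 2, eMap 1 0, eMap 1 2, eMap 2 0, eMap 2 1, eMap 0 0 - eMap 1 1]

theorem affL_traceless (i : Fin 7) :
    ∑ j, ⟪EuclideanSpace.single j (1 : ℝ), affL i (EuclideanSpace.single j 1)⟫ = 0 := by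
  fin_cases i <;>
    simp [affL, Fin.sum_univ_three, eMap_apply, EuclideanSpace.inner_single_left,
      inner_sub_right]

/-- The affine seven-family `v_i(t, x) = L_i x`, pressures `0`. -/
def affFamilyV (i : Fin 7) : ℝ → E3 → E3 := linV (affL i)
/-- Zero pressures. -/
def affFamilyQ (_ : Fin 7) : ℝ → E3 → ℝ := fun _ _ => 0

theorem affFamilyV_apply (i : Fin 7) (t : ℝ) (x : E3) : affFamilyV i t x = affL i x := rfl

theorem affFamily_sevenLinearGrowth : SevenLinearGrowth 0 affFamilyV affFamilyQ := fun i =>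
  linV_sevenLinearGrowth_clause (affL i) (affL_traceless i)

/-- The affine family is independent modulo slice-wise constants (one time sample). -/
theorem affFamily_indep_modSlice (c : Fin 7 → ℝ)
    (h : ∀ t < 0, ∃ b : E3, ∀ x : E3, ∑ i, c i • affFamilyV i t x = b) : c = 0 := by
  obtain ⟨b, hb⟩ := h (-1) (by norm_num)
  have hb0 : b = 0 := by
    rw [← hb 0]
    simp [affFamilyV_apply]
  subst hb0
  have k0 := hb (EuclideanSpace.single 0 1)
  have k1 := hb (EuclideanSpace.single 1 1)
  have k2 := hb (EuclideanSpace.single 2 1)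
  have k00 := congrArg (fun w : E3 => ⟪EuclideanSpace.single (0 : Fin 3) (1 : ℝ), w⟫) k0
  have k01 := congrArg (fun w : E3 => ⟪EuclideanSpace.single (1 : Fin 3) (1 : ℝ), w⟫) k0
  have k02 := congrArg (fun w : E3 => ⟪EuclideanSpace.single (2 : Fin 3) (1 : ℝ), w⟫) k0
  have k10 := congrArg (fun w : E3 => ⟪EuclideanSpace.single (0 : Fin 3) (1 : ℝ), w⟫) k1
  have k11 := congrArg (fun w : E3 => ⟪EuclideanSpace.single (1 : Fin 3) (1 : ℝ), w⟫) k1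
  have k12 := congrArg (fun w : E3 => ⟪EuclideanSpace.single (2 : Fin 3) (1 : ℝ), w⟫) k1
  have k20 := congrArg (fun w : E3 => ⟪EuclideanSpace.single (0 : Fin 3) (1 : ℝ), w⟫) k2
  have k21 := congrArg (fun w : E3 => ⟪EuclideanSpace.single (1 : Fin 3) (1 : ℝ), w⟫) k2
  simp [Fin.sum_univ_seven, affFamilyV_apply, affL, eMap_apply, inner_add_right,
    inner_smul_right, EuclideanSpace.inner_single_left] at k00 k01 k02 k10 k11 k12 k20 k21
  funext i
  fin_cases i <;> simp <;> linarith

/-- **Load-bearing (b).** Any proof of the crux must use the decay of the tempered class as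
`t → −∞`: with locally-uniform linear growth instead, the affine modes refute it at `u = 0`. -/
theorem linearLiouvilleSeven_false_without_backward_decay :
    ¬ LinearLiouvilleSevenWithoutBackwardDecay := by
  intro h
  obtain ⟨c, hc, hdep⟩ := h 0 0 (inClassA_zero le_rfl) affFamilyV affFamilyQ
    affFamily_sevenLinearGrowth
  exact hc (affFamily_indep_modSlice c hdep)



/-! ## §4 The Galilean collapse in disprover's form: `GalileanNontrivial → ¬ LinearLiouvilleSeven`

The lead's line (galilean-collapse, Part B) is `LL7 ∧ GaugeBounds ⇒ X`. Here is its contrapositive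
with everything except the analytic input PROVED: if some `u ∈ A_C` is nonzero somewhere on `t < 0`
and ADMITS the modulated Galilean Jacobi fields `v_{φ,e} = φ′e − φ ∂ₑu` as tempered linearised
solutions (true for every element of `A_C` by KNSS 2009 Prop. 4.1 + the Galilean Jacobi identity —
known, unformalised), then `LinearLiouvilleSeven` is FALSE. Ingredients proved below: the seven
modulations `φ_k = (1−t)^{−(k+1)}` are admissible (`phiMod_isModulation`); a slice-constant
combination with nonvanishing total modulation freezes `∂ₑu(t,·)` (`fderiv_apply_const_of_sliceConstant`);
the total modulation `Σ cₖφₖ = P(g)`, `P ≠ 0`, vanishes at finitely many times (`finite_zeroSet`);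
frozen partials + Type-I boundedness ⇒ constant slices (`slice_const_of_frozen`); constant slices off
a null set of times + the Oseen integral equation ⇒ `u(t,x) = u(s,0)` (`mild_eq_const`, heat kernel of
mass one + oddness of the Oseen kernel, tree `KNSSRemark61`); Type-I decay as `s → −∞` ⇒ `u = 0`.
So `LL7` FAILS AT EVERY NONZERO ADMISSIBLE ELEMENT OF `A_C`: its failure set inside `A_C` is exactly
`A_C ∖ {0}` (modulo the admissibility theorem), i.e. `¬LL7 ⟺ ¬X`. -/

section Galilean

/-- Admissible modulations: smooth on `(−∞,0)` with `|φ|, √(−t)|φ′|, √(−t)³|φ″| ≤ M`. -/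
def IsModulation (φ : ℝ → ℝ) : Prop :=
  ContDiffOn ℝ (⊤ : ℕ∞) φ (Set.Iio 0) ∧ ∃ M : ℝ, ∀ t < 0,
    |φ t| ≤ M ∧ Real.sqrt (-t) * |deriv φ t| ≤ M ∧ Real.sqrt (-t) ^ 3 * |deriv (deriv φ) t| ≤ M

/-- The modulated Galilean Jacobi field `v_{φ,e}(t,x) = φ′(t) e − φ(t) ∂ₑu(t,x)`. -/
def galMode (u : ℝ → E3 → E3) (e : E3) (φ : ℝ → ℝ) : ℝ → E3 → E3 :=
  fun t x => deriv φ t • e - φ t • fderiv ℝ (u t) x e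

/-- `u` ADMITS THE GALILEAN MODES: every modulated Galilean Jacobi field about `u` is a tempered
classical solution of the linearised system for some pressure (namely `q = −φ″⟪e,x⟫ − φ ∂ₑp`).
TRUE for every `u ∈ A_C` by the KNSS gauge bounds `|∇u| ≤ C₁/(−t)`, `|∇p| ≤ C₃(−t)^{−3/2}`
(KNSS 2009 Prop. 4.1) and the Galilean Jacobi identity (line galilean-collapse; triage r1-1 §A.1);
known, not yet formalised in the tree. [cite: KNSS2009, Prop. 4.1] -/
def GalileanAdmissible (u : ℝ → E3 → E3) : Prop :=
  ∀ (e : E3) (φ : ℝ → ℝ), IsModulation φ →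
    ∃ q : ℝ → E3 → ℝ, IsTemperedLinearisedNSSolution u (galMode u e φ) q

/-- **H.** Some `A_C` has an element, nonzero somewhere on `t < 0`, admitting the Galilean modes.
Given KNSS regularity this is `¬ X` (a nonzero Type-I ancient mild solution) — OPEN, hence not
constructible here. -/
def GalileanNontrivial : Prop :=
  ∃ (C : ℝ) (u : ℝ → E3 → E3), InClassA C u ∧ GalileanAdmissible u ∧ ∃ t < 0, ∃ x, u t x ≠ 0

/-! ### The seven modulations `φ_k = g^{k+1}`, `g = (1 − t)⁻¹` -/

/-- `g(t) = (1 − t)⁻¹ ∈ (0, 1]` for `t < 0`; `g′ = g²`. -/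
def gmod (t : ℝ) : ℝ := (1 - t)⁻¹

/-- `φ_k = g^{k+1}`, `k = 0, …, 6`. -/
def phiMod (k : Fin 7) (t : ℝ) : ℝ := gmod t ^ (k.val + 1)

theorem gmod_pos {t : ℝ} (ht : t < 0) : 0 < gmod t := inv_pos.2 (by linarith)

theorem gmod_le_one {t : ℝ} (ht : t < 0) : gmod t ≤ 1 := inv_le_one_of_one_le₀ (by linarith)

theorem sqrt_mul_gmod_le_one {t : ℝ} (ht : t < 0) : Real.sqrt (-t) * gmod t ≤ 1 := by
  have h1 : 0 < 1 - t := by linarith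
  have hs : Real.sqrt (-t) ≤ 1 - t := by
    have h2 : Real.sqrt (-t) ^ 2 = -t := Real.sq_sqrt (by linarith)
    nlinarith [sq_nonneg (Real.sqrt (-t) - 1 / 2), Real.sqrt_nonneg (-t)]
  unfold gmod
  rw [← div_eq_mul_inv, div_le_one h1]
  exact hs

theorem hasDerivAt_gmod {t : ℝ} (ht : t < 0) : HasDerivAt gmod (gmod t ^ 2) t :=
  hasDerivAt_inv_sub (a := 1) (by linarith)

theorem hasDerivAt_phiMod (k : Fin 7) {t : ℝ} (ht : t < 0) :
    HasDerivAt (phiMod k) ((k.val + 1 : ℝ) * gmod t ^ (k.val + 2)) t := by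
  have h : HasDerivAt (phiMod k) (↑(k.val + 1) * gmod t ^ (k.val + 1 - 1) * gmod t ^ 2) t :=
    (hasDerivAt_gmod ht).pow (k.val + 1)
  refine h.congr_deriv ?_
  rw [Nat.add_sub_cancel]
  push_cast
  ring

theorem deriv_phiMod {k : Fin 7} {t : ℝ} (ht : t < 0) :
    deriv (phiMod k) t = (k.val + 1 : ℝ) * gmod t ^ (k.val + 2) :=
  (hasDerivAt_phiMod k ht).deriv

theorem hasDerivAt_deriv_phiMod (k : Fin 7) {t : ℝ} (ht : t < 0) :
    HasDerivAt (deriv (phiMod k)) ((k.val + 1 : ℝ) * (k.val + 2) * gmod t ^ (k.val + 3)) t := by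
  have h1 : HasDerivAt (fun s => (k.val + 1 : ℝ) * gmod s ^ (k.val + 2))
      ((k.val + 1 : ℝ) * (↑(k.val + 2) * gmod t ^ (k.val + 2 - 1) * gmod t ^ 2)) t :=
    ((hasDerivAt_gmod ht).pow (k.val + 2)).const_mul _
  have h2 : deriv (phiMod k) =ᶠ[𝓝 t] fun s => (k.val + 1 : ℝ) * gmod s ^ (k.val + 2) :=
    Filter.eventuallyEq_of_mem (Iio_mem_nhds ht) fun s hs => deriv_phiMod hs
  refine (h1.congr_of_eventuallyEq h2).congr_deriv ?_
  rw [show k.val + 2 - 1 = k.val + 1 from rfl]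
  push_cast
  ring

theorem deriv_deriv_phiMod {k : Fin 7} {t : ℝ} (ht : t < 0) :
    deriv (deriv (phiMod k)) t = (k.val + 1 : ℝ) * (k.val + 2) * gmod t ^ (k.val + 3) :=
  (hasDerivAt_deriv_phiMod k ht).deriv

theorem phiMod_isModulation (k : Fin 7) : IsModulation (phiMod k) := by
  refine ⟨?_, ⟨(k.val + 1 : ℝ) * (k.val + 2), fun t ht => ⟨?_, ?_, ?_⟩⟩⟩
  · have h1 : ContDiffOn ℝ (⊤ : ℕ∞) (fun t : ℝ => (1 - t)⁻¹) (Set.Iio 0) := by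
      refine (contDiffOn_const.sub contDiffOn_id).inv ?_
      intro t ht
      simp only [Set.mem_Iio] at ht
      show (1 : ℝ) - t ≠ 0
      linarith
    exact h1.pow _
  · have hg0 := gmod_pos ht
    have hg1 := gmod_le_one ht
    have hk : (0 : ℝ) ≤ k.val := Nat.cast_nonneg _
    rw [phiMod, abs_of_pos (pow_pos hg0 _)]
    calc gmod t ^ (k.val + 1) ≤ 1 := pow_le_one₀ hg0.le hg1
      _ ≤ (k.val + 1 : ℝ) * (k.val + 2) := by nlinarith
  · have hg0 := gmod_pos ht
    have hg1 := gmod_le_one ht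
    have hsg := sqrt_mul_gmod_le_one ht
    have hk : (0 : ℝ) ≤ k.val := Nat.cast_nonneg _
    have hs0 : 0 ≤ Real.sqrt (-t) := Real.sqrt_nonneg _
    rw [deriv_phiMod ht, abs_of_pos (by positivity)]
    have e : Real.sqrt (-t) * ((k.val + 1 : ℝ) * gmod t ^ (k.val + 2)) =
        (k.val + 1 : ℝ) * ((Real.sqrt (-t) * gmod t) * gmod t ^ (k.val + 1)) := by ring
    rw [e]
    have h1 : (Real.sqrt (-t) * gmod t) * gmod t ^ (k.val + 1) ≤ 1 := by
      calc (Real.sqrt (-t) * gmod t) * gmod t ^ (k.val + 1) ≤ 1 * 1 := by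
            apply mul_le_mul hsg (pow_le_one₀ hg0.le hg1) (by positivity) zero_le_one
        _ = 1 := one_mul _
    calc (k.val + 1 : ℝ) * ((Real.sqrt (-t) * gmod t) * gmod t ^ (k.val + 1))
        ≤ (k.val + 1 : ℝ) * 1 := by apply mul_le_mul_of_nonneg_left h1; positivity
      _ ≤ (k.val + 1 : ℝ) * (k.val + 2) := by nlinarith
  · have hg0 := gmod_pos ht
    have hg1 := gmod_le_one ht
    have hsg := sqrt_mul_gmod_le_one ht
    have hk : (0 : ℝ) ≤ k.val := Nat.cast_nonneg _
    have hs0 : 0 ≤ Real.sqrt (-t) := Real.sqrt_nonneg _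
    rw [deriv_deriv_phiMod ht, abs_of_pos (by positivity)]
    have e : Real.sqrt (-t) ^ 3 * ((k.val + 1 : ℝ) * (k.val + 2) * gmod t ^ (k.val + 3)) =
        (k.val + 1 : ℝ) * (k.val + 2) * ((Real.sqrt (-t) * gmod t) ^ 3 * gmod t ^ k.val) := by
      ring
    rw [e]
    have h1 : (Real.sqrt (-t) * gmod t) ^ 3 * gmod t ^ k.val ≤ 1 := by
      calc (Real.sqrt (-t) * gmod t) ^ 3 * gmod t ^ k.val ≤ 1 * 1 := by
            apply mul_le_mul (pow_le_one₀ (by positivity) hsg) (pow_le_one₀ hg0.le hg1)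
              (by positivity) zero_le_one
        _ = 1 := one_mul _
    calc (k.val + 1 : ℝ) * (k.val + 2) * ((Real.sqrt (-t) * gmod t) ^ 3 * gmod t ^ k.val)
        ≤ (k.val + 1 : ℝ) * (k.val + 2) * 1 := by
          apply mul_le_mul_of_nonneg_left h1; positivity
      _ = (k.val + 1 : ℝ) * (k.val + 2) := mul_one _

/-! ### S1–S2: a slice-constant combination freezes `∂ₑu(t,·)` where the total modulation is nonzero -/

theorem sum_smul_galMode (u : ℝ → E3 → E3) (e : E3) (φ : Fin 7 → ℝ → ℝ) (c : Fin 7 → ℝ)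
    (t : ℝ) (x : E3) :
    ∑ i, c i • galMode u e (φ i) t x =
      (∑ i, c i * deriv (φ i) t) • e - (∑ i, c i * φ i t) • fderiv ℝ (u t) x e := by
  simp only [galMode, smul_sub, smul_smul, Finset.sum_sub_distrib, Finset.sum_smul]

theorem fderiv_apply_const_of_sliceConstant {u : ℝ → E3 → E3} {e : E3} {φ : Fin 7 → ℝ → ℝ}
    {c : Fin 7 → ℝ} {t : ℝ} (h : ∃ b : E3, ∀ x, ∑ i, c i • galMode u e (φ i) t x = b)
    (hΦ : ∑ i, c i * φ i t ≠ 0) (x : E3) : fderiv ℝ (u t) x e = fderiv ℝ (u t) 0 e := by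
  obtain ⟨b, hb⟩ := h
  have h1 := hb x
  have h0 := hb 0
  rw [sum_smul_galMode] at h1 h0
  have h2 : (∑ i, c i * φ i t) • fderiv ℝ (u t) 0 e = (∑ i, c i * φ i t) • fderiv ℝ (u t) x e :=
    sub_right_inj.1 (h0.trans h1.symm)
  exact ((smul_right_injective E3 hΦ) h2).symm

/-! ### S3: the total modulation has finitely many zeros -/

/-- `Σ cᵢ φᵢ = P_c(g)` with `P_c = Σ cᵢ X^{i+1}`. -/
def modPoly (c : Fin 7 → ℝ) : Polynomial ℝ :=
  ∑ i, Polynomial.C (c i) * Polynomial.X ^ (i.val + 1)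

theorem totalMod_eq_eval (c : Fin 7 → ℝ) (t : ℝ) :
    ∑ i, c i * phiMod i t = (modPoly c).eval (gmod t) := by
  simp [modPoly, phiMod, Polynomial.eval_finsetSum]

theorem modPoly_coeff (c : Fin 7 → ℝ) (j : Fin 7) : (modPoly c).coeff (j.val + 1) = c j := by
  simp only [modPoly, Polynomial.finsetSum_coeff, Polynomial.coeff_C_mul, Polynomial.coeff_X_pow]
  rw [Finset.sum_eq_single j]
  · simp
  · intro i _ hij
    have hne : j.val ≠ i.val := fun h => hij (Fin.ext h.symm)
    simp [hne]
  · intro h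
    exact absurd (Finset.mem_univ j) h

theorem modPoly_ne_zero {c : Fin 7 → ℝ} (hc : c ≠ 0) : modPoly c ≠ 0 := by
  intro h
  apply hc
  funext j
  have := modPoly_coeff c j
  rw [h, Polynomial.coeff_zero] at this
  exact this.symm

theorem gmod_injective : Function.Injective gmod := by
  intro a b h
  have := inv_inj.1 h
  linarith

theorem finite_zeroSet {c : Fin 7 → ℝ} (hc : c ≠ 0) :
    {t : ℝ | ∑ i, c i * phiMod i t = 0}.Finite := by
  have hfin : {r : ℝ | (modPoly c).IsRoot r}.Finite :=
    Polynomial.finite_setOf_isRoot (modPoly_ne_zero hc)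
  have hpre : (gmod ⁻¹' {r : ℝ | (modPoly c).IsRoot r}).Finite :=
    hfin.preimage gmod_injective.injOn
  refine hpre.subset ?_
  intro t ht
  simp only [Set.mem_setOf_eq] at ht
  simp only [Set.mem_preimage, Set.mem_setOf_eq, Polynomial.IsRoot.def, ← totalMod_eq_eval]
  exact ht

/-! ### S4–S5: frozen partials and bounded slices force constant slices -/

/-- A bounded differentiable field whose derivative along `e` is a constant `m` has `m = 0`. -/
theorem dirDeriv_const_eq_zero {f : E3 → E3} (hf : Differentiable ℝ f) {e m : E3}
    (hm : ∀ x, fderiv ℝ f x e = m) {B : ℝ} (hB : ∀ x, ‖f x‖ ≤ B) : m = 0 := by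
  have hline : ∀ s : ℝ, HasDerivAt (fun s : ℝ => f (s • e)) m s := by
    intro s
    have h1 : HasDerivAt (fun s : ℝ => s • e) e s := by
      simpa using (hasDerivAt_id s).smul_const e
    have h2 := (hf (s • e)).hasFDerivAt.comp_hasDerivAt s h1
    simpa [Function.comp_def, hm] using h2
  have hconst : ∀ s : ℝ, f (s • e) - s • m = f 0 := by
    intro s
    have hsub : ∀ s : ℝ, HasDerivAt (fun s : ℝ => f (s • e) - s • m) (m - (1 : ℝ) • m) s :=
      fun s => (hline s).sub ((hasDerivAt_id' s).smul_const m)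
    have hd : Differentiable ℝ (fun s : ℝ => f (s • e) - s • m) := fun s =>
      (hsub s).differentiableAt
    have hz : ∀ s, deriv (fun s : ℝ => f (s • e) - s • m) s = 0 := fun s => by
      rw [(hsub s).deriv]; simp
    have := is_const_of_deriv_eq_zero hd hz s 0
    simpa using this
  by_contra hm0
  have hmpos : 0 < ‖m‖ := norm_pos_iff.2 hm0
  have hB0 : 0 ≤ B := (norm_nonneg _).trans (hB 0)
  set s : ℝ := (2 * B + 1) / ‖m‖ with hs
  have hs0 : 0 < s := by positivity
  have key : ‖s • m‖ ≤ 2 * B := by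
    have e1 : s • m = f (s • e) - f 0 := by rw [← hconst s]; abel
    rw [e1]
    calc ‖f (s • e) - f 0‖ ≤ ‖f (s • e)‖ + ‖f 0‖ := norm_sub_le _ _
      _ ≤ B + B := add_le_add (hB _) (hB _)
      _ = 2 * B := by ring
  rw [norm_smul, Real.norm_eq_abs, abs_of_pos hs0, hs, div_mul_cancel₀ _ hmpos.ne'] at key
  linarith

theorem clm_eq_zero_of_basis (A : E3 →L[ℝ] E3)
    (h : ∀ j : Fin 3, A (EuclideanSpace.single j 1) = 0) : A = 0 := by
  refine ContinuousLinearMap.ext fun x => ?_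
  have hx := (EuclideanSpace.basisFun (Fin 3) ℝ).sum_repr x
  rw [← hx]
  simp [map_sum, h]

/-- All three partials frozen (equal to their value at `0`) and bounded slices ⇒ the slice is
constant. -/
theorem slice_const_of_frozen {f : E3 → E3} (hf : Differentiable ℝ f)
    (hm : ∀ j : Fin 3, ∀ x, fderiv ℝ f x (EuclideanSpace.single j 1) =
      fderiv ℝ f 0 (EuclideanSpace.single j 1))
    {B : ℝ} (hB : ∀ x, ‖f x‖ ≤ B) (x : E3) : f x = f 0 := by
  have hz : ∀ j : Fin 3, fderiv ℝ f 0 (EuclideanSpace.single j 1) = 0 := fun j =>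
    dirDeriv_const_eq_zero hf (hm j) hB
  have hD : ∀ y, fderiv ℝ f y = 0 := fun y =>
    clm_eq_zero_of_basis _ fun j => by rw [hm j y, hz j]
  exact is_const_of_fderiv_eq_zero hf hD x 0

/-! ### S6: the Oseen integral equation with slices constant off a finite set of times -/

theorem mild_eq_const {u : ℝ → E3 → E3}
    (hmild : ∀ s t : ℝ, s < t → t < 0 → ∀ x, u t x = heatFlow (u s) (t - s) x -
      ∫ τ in Set.Ioo s t, ∫ y, oseenKernel (t - τ) (x - y) (u τ y) (u τ y))
    {Z : Set ℝ} (hZ : Z.Finite) {s t : ℝ} (hst : s < t) (ht : t < 0) (hs : s ∉ Z)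
    (hconst : ∀ τ, τ < 0 → τ ∉ Z → ∀ y, u τ y = u τ 0) (x : E3) : u t x = u s 0 := by
  rw [hmild s t hst ht x]
  have hσ : 0 < t - s := sub_pos.2 hst
  have hus : u s = fun _ => u s 0 := funext fun y => hconst s (hst.trans ht) hs y
  have h1 : heatFlow (u s) (t - s) x = u s 0 := by
    rw [heatFlow_of_pos _ hσ, hus, UnboundedOperators.heatExtension_const (u s 0) hσ x]
  have h2 : ∫ τ in Set.Ioo s t, ∫ y, oseenKernel (t - τ) (x - y) (u τ y) (u τ y) = 0 := by
    refine integral_eq_zero_of_ae ?_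
    have hZ0 : (volume.restrict (Set.Ioo s t)) Z = 0 := hZ.measure_zero _
    have hae1 : ∀ᵐ τ ∂(volume.restrict (Set.Ioo s t)), τ ∉ Z := compl_mem_ae_iff.2 hZ0
    have hae2 : ∀ᵐ τ ∂(volume.restrict (Set.Ioo s t)), τ ∈ Set.Ioo s t :=
      ae_restrict_mem measurableSet_Ioo
    filter_upwards [hae1, hae2] with τ hτZ hτ
    have hcτ : (fun y => oseenKernel (t - τ) (x - y) (u τ y) (u τ y)) =
        fun y => oseenKernel (t - τ) (x - y) (u τ 0) (u τ 0) :=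
      funext fun y => by rw [hconst τ (hτ.2.trans ht) hτZ y]
    simp only [Pi.zero_apply]
    rw [hcτ]
    exact integral_oseenKernel_sub_left_eq_zero _ x _ _
  rw [h1, h2, sub_zero]

/-! ### S7: assembly -/

/-- **Negative lemma modulo `H = GalileanNontrivial`.** `LinearLiouvilleSeven` fails about every
nonzero element of `A_C` that admits the Galilean modes; in particular (given the KNSS gauge
regularity making every element admissible) `¬ LinearLiouvilleSeven ⟺ ¬ TypeIAncientLiouville`. -/
theorem linearLiouvilleSeven_false_of_galileanNontrivial :
    GalileanNontrivial → ¬ LinearLiouvilleSeven := by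
  rintro ⟨C, u, hA, hGal, t₀, ht₀, x₀, hne⟩ hLL
  rw [linearLiouvilleSeven_iff] at hLL
  -- S1: LL7 applied, for each direction, to the seven modulated Galilean modes
  have step1 : ∀ j : Fin 3, ∃ c : Fin 7 → ℝ, c ≠ 0 ∧ ∀ t < 0, ∃ b : E3, ∀ x,
      ∑ i, c i • galMode u (EuclideanSpace.single j 1) (phiMod i) t x = b := by
    intro j
    choose q hq using
      fun i : Fin 7 => hGal (EuclideanSpace.single j 1) (phiMod i) (phiMod_isModulation i)
    exact hLL C u hA (fun i => galMode u (EuclideanSpace.single j 1) (phiMod i)) q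
      ((sevenTempered_iff u _ q).2 hq)
  choose c hc hdep using step1
  -- the finite set of bad times
  set Z : Set ℝ := ⋃ j : Fin 3, {t : ℝ | ∑ i, c j i * phiMod i t = 0} with hZdef
  have hZ : Z.Finite := Set.finite_iUnion fun j => finite_zeroSet (hc j)
  obtain ⟨hsm, -, hmild, hTI⟩ := hA
  have hdiff : ∀ t < 0, Differentiable ℝ (u t) := fun t ht =>
    ((show IsSmoothSpaceTimeOn (Set.Iio 0) u from hsm).contDiff_slice ht).differentiable (by simp)
  -- S2–S5: off `Z` every slice of `u` is constant
  have hconst : ∀ τ, τ < 0 → τ ∉ Z → ∀ y, u τ y = u τ 0 := by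
    intro τ hτ hτZ y
    have hΦ : ∀ j : Fin 3, ∑ i, c j i * phiMod i τ ≠ 0 := fun j hj =>
      hτZ (Set.mem_iUnion.2 ⟨j, hj⟩)
    have hfro : ∀ j : Fin 3, ∀ x, fderiv ℝ (u τ) x (EuclideanSpace.single j 1) =
        fderiv ℝ (u τ) 0 (EuclideanSpace.single j 1) := fun j x =>
      fderiv_apply_const_of_sliceConstant (hdep j τ hτ) (hΦ j) x
    exact slice_const_of_frozen (hdiff τ hτ) hfro (fun x => hTI τ hτ x) y
  -- S6: `u t₀ x₀ = u s 0` for every good time `s < t₀`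
  have hval : ∀ s, s < t₀ → s ∉ Z → u t₀ x₀ = u s 0 := fun s hs hsZ =>
    mild_eq_const hmild hZ hs ht₀ hsZ hconst x₀
  -- S7: Type-I decay along `s → −∞`
  apply hne
  by_contra h0
  have hpos : 0 < ‖u t₀ x₀‖ := norm_pos_iff.2 h0
  obtain ⟨L, hL⟩ := hZ.bddBelow
  set R : ℝ := (C / ‖u t₀ x₀‖) ^ 2 with hR
  set s : ℝ := min (min t₀ L) (-R) - 1 with hsdef
  have hm1 : min (min t₀ L) (-R) ≤ t₀ := (min_le_left _ _).trans (min_le_left _ _)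
  have hm2 : min (min t₀ L) (-R) ≤ L := (min_le_left _ _).trans (min_le_right _ _)
  have hm3 : min (min t₀ L) (-R) ≤ -R := min_le_right _ _
  have hs_t : s < t₀ := by linarith
  have hsZ : s ∉ Z := fun h => by have := hL h; linarith
  have hs0 : s < 0 := hs_t.trans ht₀
  have key := hval s hs_t hsZ
  have hTIs := hTI s hs0 0
  rw [← key] at hTIs
  have hRs : R + 1 ≤ -s := by linarith
  have hR0 : 0 ≤ R := sq_nonneg _
  have hrs : 0 < Real.sqrt (-s) := Real.sqrt_pos.2 (by linarith)
  have hsqrt : |C / ‖u t₀ x₀‖| < Real.sqrt (-s) := by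
    rw [← Real.sqrt_sq_eq_abs]
    exact Real.sqrt_lt_sqrt (sq_nonneg _) (by linarith)
  have hlt : C / Real.sqrt (-s) < ‖u t₀ x₀‖ := by
    rw [div_lt_iff₀ hrs]
    have h1 : C / ‖u t₀ x₀‖ < Real.sqrt (-s) := lt_of_le_of_lt (le_abs_self _) hsqrt
    rw [div_lt_iff₀ hpos] at h1
    linarith [mul_comm (Real.sqrt (-s)) ‖u t₀ x₀‖]
  linarith

end Galilean



/-! ## Load-bearing (c): the pressure growth bound (strain modes)

Dropping the pressure growth `|q| ≤ K/(−t) + K(1+‖x‖)/√(−t)³` (keeping the tempered VELOCITY bound)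
lets in the time-dependent strain modes `v = (a−t)⁻¹ S x`, `q = −(a−t)⁻² ⟪x, Sx⟫/2` (`S` symmetric
traceless, `a ≥ 1`), whose pressure grows quadratically; seven of them are independent modulo
slice-constants at `u = 0`. So the pressure bound is load-bearing (it is what excludes `M(t)x`). -/

section Strain

/-- The seven-family hypothesis with the PRESSURE growth bound dropped; other clauses verbatim. -/
def SevenTemperedNoPressureBound (u : ℝ → E3 → E3) (v : Fin 7 → ℝ → E3 → E3)
    (q : Fin 7 → ℝ → E3 → ℝ) : Prop :=
  ∀ i, (ContDiffOn ℝ (⊤ : ℕ∞) (Function.uncurry (v i)) (Set.Iio 0 ×ˢ Set.univ) ∧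
    ContDiffOn ℝ (⊤ : ℕ∞) (Function.uncurry (q i)) (Set.Iio 0 ×ˢ Set.univ) ∧
    (∃ K : ℝ, ∀ t < 0, ∀ x, ‖(v i) t x‖ ≤ K / Real.sqrt (-t) + K * (1 + ‖x‖) / (-t)) ∧
    (∀ t < 0, VectorCalculus.IsDivFree ((v i) t)) ∧
    (∀ t < 0, ∀ x, timeDeriv (v i) t x + convect (u t) ((v i) t) x + convect ((v i) t) (u t) x =
      Laplacian.laplacian ((v i) t) x - gradient ((q i) t) x))

/-- Dropping the pressure bound is an honest weakening of the hypothesis. -/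
theorem sevenTemperedNoPressureBound_of_sevenTempered {u : ℝ → E3 → E3}
    {v : Fin 7 → ℝ → E3 → E3} {q : Fin 7 → ℝ → E3 → ℝ} (h : SevenTempered u v q) :
    SevenTemperedNoPressureBound u v q := fun i => by
  obtain ⟨h1, h2, ⟨K, hK⟩, h4, h5⟩ := h i
  exact ⟨h1, h2, ⟨K, fun t ht x => (hK t ht x).1⟩, h4, h5⟩

/-- The crux with the pressure growth bound dropped. -/
def LinearLiouvilleSevenWithoutPressureBound : Prop :=
  ∀ C u, InClassA C u → ∀ v q, SevenTemperedNoPressureBound u v q → DependentModSlice v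

/-- Strain mode `v(t,x) = (a − t)⁻¹ S x`. -/
def strainV (a : ℝ) (S : E3 →L[ℝ] E3) : ℝ → E3 → E3 := fun t x => (a - t)⁻¹ • S x

/-- Its pressure `q(t,x) = −(a − t)⁻² ⟪x, Sx⟫ / 2` (quadratic growth). -/
def strainQ (a : ℝ) (S : E3 →L[ℝ] E3) : ℝ → E3 → ℝ :=
  fun t x => -((a - t)⁻¹ ^ 2 / 2 * ⟪x, S x⟫)

/-- Slices of the strain mode are the linear maps `(a−t)⁻¹ S`. -/
theorem strainV_slice (a : ℝ) (S : E3 →L[ℝ] E3) (t : ℝ) :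
    strainV a S t = ⇑((a - t)⁻¹ • S) := by
  funext x; simp [strainV]

/-- The quadratic form of a symmetric map has gradient `2Sx`. -/
theorem hasFDerivAt_inner_self_clm (S : E3 →L[ℝ] E3) (hS : ∀ x y, ⟪S x, y⟫ = ⟪x, S y⟫) (x : E3) :
    HasFDerivAt (fun y : E3 => ⟪y, S y⟫) (InnerProductSpace.toDual ℝ E3 ((2 : ℝ) • S x)) x := by
  have h := (hasFDerivAt_id (𝕜 := ℝ) x).inner ℝ (S.hasFDerivAt (x := x))
  refine h.congr_fderiv ?_
  refine ContinuousLinearMap.ext fun y => ?_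
  simp only [InnerProductSpace.toDual_apply_apply, ContinuousLinearMap.comp_apply,
    ContinuousLinearMap.prod_apply, fderivInnerCLM_apply, id_eq, ContinuousLinearMap.id_apply]
  rw [real_inner_smul_left, real_inner_comm (S x) y, hS x y]
  ring

/-- Strain modes (symmetric traceless `S`, `a ≥ 1`) satisfy the no-pressure-bound clause about `u = 0`. -/
theorem strain_clause {a : ℝ} (ha : 1 ≤ a) (S : E3 →L[ℝ] E3) (hS : ∀ x y, ⟪S x, y⟫ = ⟪x, S y⟫)
    (htr : ∑ i, ⟪EuclideanSpace.single i (1 : ℝ), S (EuclideanSpace.single i 1)⟫ = 0) :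
    (ContDiffOn ℝ (⊤ : ℕ∞) (Function.uncurry (strainV a S)) (Set.Iio 0 ×ˢ Set.univ) ∧
    ContDiffOn ℝ (⊤ : ℕ∞) (Function.uncurry (strainQ a S)) (Set.Iio 0 ×ˢ Set.univ) ∧
    (∃ K : ℝ, ∀ t < 0, ∀ x, ‖(strainV a S) t x‖ ≤ K / Real.sqrt (-t) + K * (1 + ‖x‖) / (-t)) ∧
    (∀ t < 0, VectorCalculus.IsDivFree ((strainV a S) t)) ∧
    (∀ t < 0, ∀ x, timeDeriv (strainV a S) t x + convect ((0 : ℝ → E3 → E3) t) ((strainV a S) t) x +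
      convect ((strainV a S) t) ((0 : ℝ → E3 → E3) t) x =
      Laplacian.laplacian ((strainV a S) t) x - gradient ((strainQ a S) t) x)) := by
  have hinv := contDiffOn_inv_sub_fst (a := a) (by linarith)
  refine ⟨?_, ?_, ⟨‖S‖, fun t ht x => ?_⟩, ?_, ?_⟩
  · change ContDiffOn ℝ (⊤ : ℕ∞) (fun p : ℝ × E3 => (a - p.1)⁻¹ • S p.2) (Set.Iio 0 ×ˢ Set.univ)
    exact hinv.smul (S.contDiff.comp contDiff_snd).contDiffOn
  · change ContDiffOn ℝ (⊤ : ℕ∞) (fun p : ℝ × E3 => -((a - p.1)⁻¹ ^ 2 / 2 * ⟪p.2, S p.2⟫))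
      (Set.Iio 0 ×ˢ Set.univ)
    exact (((hinv.pow 2).div_const 2).mul
      (contDiffOn_snd.inner ℝ (S.contDiff.comp contDiff_snd).contDiffOn)).neg
  · have hat : 0 < a - t := by linarith
    have hnt : 0 < -t := by linarith
    show ‖(a - t)⁻¹ • S x‖ ≤ _
    rw [norm_smul, Real.norm_eq_abs, abs_of_pos (inv_pos.2 hat)]
    have hS0 : 0 ≤ ‖S‖ := norm_nonneg _
    calc (a - t)⁻¹ * ‖S x‖ ≤ (-t)⁻¹ * (‖S‖ * ‖x‖) := by
          apply mul_le_mul (inv_anti₀ hnt (by linarith)) (S.le_opNorm x) (norm_nonneg _)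
          positivity
      _ ≤ (-t)⁻¹ * (‖S‖ * (1 + ‖x‖)) := by gcongr; linarith
      _ = ‖S‖ * (1 + ‖x‖) / (-t) := by ring
      _ ≤ ‖S‖ / Real.sqrt (-t) + ‖S‖ * (1 + ‖x‖) / (-t) := le_add_of_nonneg_left (by positivity)
  · intro t _ x
    show VectorCalculus.divergence (strainV a S t) x = 0
    rw [strainV_slice, divergence_clm]
    simp only [FunLike.coe_smul, Pi.smul_apply, inner_smul_right, ← Finset.mul_sum, htr,
      mul_zero]
  · intro t ht x
    have hat : a - t ≠ 0 := by intro h; linarith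
    have e1 : timeDeriv (strainV a S) t x = ((a - t)⁻¹ ^ 2) • S x := by
      simp only [timeDeriv, strainV]
      exact ((hasDerivAt_inv_sub hat).smul_const (S x)).deriv
    have e2 : convect ((0 : ℝ → E3 → E3) t) ((strainV a S) t) x = 0 := by simp [convect]
    have e3 : convect ((strainV a S) t) ((0 : ℝ → E3 → E3) t) x = 0 := by simp [convect]
    have e4 : Δ ((strainV a S) t) x = 0 := by rw [strainV_slice, laplacian_clm]
    have e5 : gradient ((strainQ a S) t) x = (-((a - t)⁻¹ ^ 2)) • S x := by
      have hq := ((hasFDerivAt_inner_self_clm S hS x).const_mul ((a - t)⁻¹ ^ 2 / 2)).neg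
      have hg : HasGradientAt (strainQ a S t) ((-((a - t)⁻¹ ^ 2)) • S x) x := by
        rw [hasGradientAt_iff_hasFDerivAt]
        have e : -(((a - t)⁻¹ ^ 2 / 2) • InnerProductSpace.toDual ℝ E3 ((2 : ℝ) • S x)) =
            InnerProductSpace.toDual ℝ E3 ((-((a - t)⁻¹ ^ 2)) • S x) := by
          rw [← (InnerProductSpace.toDual ℝ E3).map_smul, smul_smul, ← map_neg, ← neg_smul]
          congr 2
          ring
        rw [← e]
        exact hq
      exact hg.gradient
    rw [e1, e2, e3, e4, e5, add_zero, add_zero, neg_smul, zero_sub, neg_neg]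

/-- Symmetric elementary maps `x_b e_a + x_a e_b` … -/
def symMap (a b : Fin 3) : E3 →L[ℝ] E3 := eMap a b + eMap b a

/-- … and traceless diagonal maps `x_a e_a − x_b e_b`. -/
def diagMap (a b : Fin 3) : E3 →L[ℝ] E3 := eMap a a - eMap b b

/-- `symMap` is symmetric. -/
theorem symMap_symm (a b : Fin 3) (x y : E3) : ⟪symMap a b x, y⟫ = ⟪x, symMap a b y⟫ := by
  simp [symMap, eMap_apply, inner_add_left, inner_add_right, real_inner_smul_left,
    real_inner_smul_right, EuclideanSpace.inner_single_left, EuclideanSpace.inner_single_right]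
  ring

/-- `diagMap` is symmetric. -/
theorem diagMap_symm (a b : Fin 3) (x y : E3) : ⟪diagMap a b x, y⟫ = ⟪x, diagMap a b y⟫ := by
  simp [diagMap, eMap_apply, inner_sub_left, inner_sub_right, real_inner_smul_left,
    real_inner_smul_right, EuclideanSpace.inner_single_left, EuclideanSpace.inner_single_right]
  ring

/-- The seven strain generators. -/
def strainS : Fin 7 → (E3 →L[ℝ] E3) :=
  ![symMap 0 1, symMap 0 2, symMap 1 2, diagMap 0 1, diagMap 1 2, symMap 0 1, symMap 0 2]

/-- Their time shifts. -/
def strainShift : Fin 7 → ℝ := ![1, 1, 1, 1, 1, 2, 2]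

/-- The seven generators are symmetric. -/
theorem strainS_symm (i : Fin 7) (x y : E3) : ⟪strainS i x, y⟫ = ⟪x, strainS i y⟫ := by
  fin_cases i <;> simp [strainS, symMap_symm, diagMap_symm]

/-- The seven generators are traceless. -/
theorem strainS_traceless (i : Fin 7) :
    ∑ j, ⟪EuclideanSpace.single j (1 : ℝ), strainS i (EuclideanSpace.single j 1)⟫ = 0 := by
  fin_cases i <;>
    simp [strainS, symMap, diagMap, Fin.sum_univ_three, eMap_apply, EuclideanSpace.inner_single_left]

/-- All shifts are `≥ 1`. -/
theorem one_le_strainShift (i : Fin 7) : 1 ≤ strainShift i := by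
  fin_cases i <;> simp [strainShift]

/-- The seven strain modes and their pressures. -/
def strainFamilyV (i : Fin 7) : ℝ → E3 → E3 := strainV (strainShift i) (strainS i)
/-- Pressures of the strain family. -/
def strainFamilyQ (i : Fin 7) : ℝ → E3 → ℝ := strainQ (strainShift i) (strainS i)

/-- Unfolding the strain family. -/
theorem strainFamilyV_apply (i : Fin 7) (t : ℝ) (x : E3) :
    strainFamilyV i t x = (strainShift i - t)⁻¹ • strainS i x := rfl

/-- The strain family satisfies the no-pressure-bound hypothesis about `u = 0`. -/
theorem strainFamily_clause : SevenTemperedNoPressureBound 0 strainFamilyV strainFamilyQ := fun i =>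
  strain_clause (one_le_strainShift i) (strainS i) (strainS_symm i) (strainS_traceless i)

/-- The strain family is independent modulo slice-wise constants (two time samples). -/
theorem strainFamily_indep_modSlice (c : Fin 7 → ℝ)
    (h : ∀ t < 0, ∃ b : E3, ∀ x : E3, ∑ i, c i • strainFamilyV i t x = b) : c = 0 := by
  obtain ⟨b1, hb1⟩ := h (-1) (by norm_num)
  obtain ⟨b2, hb2⟩ := h (-2) (by norm_num)
  have hb10 : b1 = 0 := by rw [← hb1 0]; simp [strainFamilyV_apply]
  have hb20 : b2 = 0 := by rw [← hb2 0]; simp [strainFamilyV_apply]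
  subst hb10; subst hb20
  have k1 := congrArg (fun w : E3 => ⟪EuclideanSpace.single (1 : Fin 3) (1 : ℝ), w⟫) (hb1 (EuclideanSpace.single 0 1))
  have k2 := congrArg (fun w : E3 => ⟪EuclideanSpace.single (2 : Fin 3) (1 : ℝ), w⟫) (hb1 (EuclideanSpace.single 0 1))
  have k3 := congrArg (fun w : E3 => ⟪EuclideanSpace.single (0 : Fin 3) (1 : ℝ), w⟫) (hb1 (EuclideanSpace.single 0 1))
  have k4 := congrArg (fun w : E3 => ⟪EuclideanSpace.single (2 : Fin 3) (1 : ℝ), w⟫) (hb1 (EuclideanSpace.single 1 1))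
  have k5 := congrArg (fun w : E3 => ⟪EuclideanSpace.single (2 : Fin 3) (1 : ℝ), w⟫) (hb1 (EuclideanSpace.single 2 1))
  have k6 := congrArg (fun w : E3 => ⟪EuclideanSpace.single (1 : Fin 3) (1 : ℝ), w⟫) (hb2 (EuclideanSpace.single 0 1))
  have k7 := congrArg (fun w : E3 => ⟪EuclideanSpace.single (2 : Fin 3) (1 : ℝ), w⟫) (hb2 (EuclideanSpace.single 0 1))
  simp [Fin.sum_univ_seven, strainFamilyV_apply, strainS, strainShift, symMap, diagMap, eMap_apply,
    inner_add_right, inner_smul_right, EuclideanSpace.inner_single_left] at k1 k2 k3 k4 k5 k6 k7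
  norm_num at k1 k2 k3 k4 k5 k6 k7
  funext i
  fin_cases i <;> simp <;> linarith

/-- **Load-bearing (c).** Any proof of the crux must use the pressure growth bound: without it the
strain modes refute the statement at `u = 0`. -/
theorem linearLiouvilleSeven_false_without_pressure_bound :
    ¬ LinearLiouvilleSevenWithoutPressureBound := by
  intro h
  obtain ⟨c, hc, hdep⟩ := h 0 0 (inClassA_zero le_rfl) strainFamilyV strainFamilyQ strainFamily_clause
  exact hc (strainFamily_indep_modSlice c hdep)

end Strain

end Summit.NavierStokesRegularity.NavierStokesRegularity.Cruxes.LinearLiouvilleSeven.Disproof
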